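import Literature.MathematicalPhysics.QuantumFieldTheory.Balaban1983to89.B9Eq3105FamThreeLocDiffGRight
import Literature.MathematicalPhysics.QuantumFieldTheory.Balaban1983to89.B9Eq3105FamThreeLocDiffGOfEBlock
import Literature.MathematicalPhysics.QuantumFieldTheory.Balaban1983to89.B9Eq3105FamThreeLocCDiffChains

/-!
# `Balaban1983to89.B9Eq3105FamThreeLocCDiffOuterEntries` — FAMILY 3 OF (3.105), THE `C`-DIFFERENCE WORD: THE OUTER ENTRIES `conj(η⁻¹∇_μ)·M_{χl}·conj(η²G′_□(V′))`
# AND `conj(η²G′_□(V′))·M_{χl}·conj(−η⁻¹∇*_ν)` ON THE MEMBER CARRIER FROM THE MEMBER's (3.42) BLOCK `hE`, THE COMMUTATOR KERNELS `hR` ∕ `hGK` AND F3-E1's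
# ONE-SIDED IDENTITIES — the suppliers of FILE 7's displayed `hLw □ μ` and `hRop □ ν` (sub-row G-B9-LETTERS, GAPS G-B9-05 family 3 (D2); programme FAMTHREE, F3-B3 FILE 8a)

statement-level skeleton of published theorems with citation tags; proofs where landed; nothing here is a claim about the Yang–Mills mass gap

THE PRINTED LOCUS (held `paper:balaban1985-cmp99-background-propagators`, journal page = PDF page + 388).  p. 415 l. 29–31; p. 412 l. 22–36; (3.95)∕(3.97) pp. 411–412
(`G′(U) − G′_□ = G′_□(Δ′_□ − Δ′)G′` one-sided at the cut-offs); (3.100) p. 413 (derivatives through the cut-offs); Thm 3.1 (3.42) p. 397; (3.88)–(3.89) p. 409;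
Cor. 3.6 p. 408.  [4] = `Balaban1984PropagatorsII` (2.51)–(2.55) p. 232, Lemma 2.1 (2.60)–(2.61) p. 234.  [2] = `Balaban1983RegularityDecay` (1.11)–(1.12): statement type.

THE POINT (the device of p38's F3-E3, mirrored).  The cube letter `G′_□(V′)` NEVER carries the member's derivative: by F3-E1's identities at the (3.35) datum
(`B9Eq3105FamThreeLocDiffG.GpY_sub_GpCubeY_cutMulY_eq_at`, `cutMulY_GpY_sub_GpCubeY_eq_at`, with F3-E2a `chiL_mul_chiY`),
`G′_□(V′)·M_{χl} = (M_{χ_□} − G′_□(V′)K_χ(V′))·G′(U₁)·M_{χl}` and `M_{χl}·G′_□(V′) = M_{χl}·G′(U₁)·(M_{χ_□} − R_χ(V′))` (`K_χ = Δ′_□M_{χ_□} − M_{χ_□}Δ′_□`,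
`R_χ = (M_{χ_□}Δ′_□ − Δ′_□M_{χ_□})G′_□`), so both outer entries are the member's own (3.42) entries through the cut-off ((3.100): p38 `conj_cut_gradB_split` +
`hasMajorant_colL_G_gradB` ∕ `_dchi` on the right; p33 engine `hasMajorant_leftFactor` + `conj_diffLetter_mul_cutMulY` on the left) times the derivative-free
commutator kernels `hGK` (right, displayed as in F3-E3) ∕ `R_χ` (left, F3-E2d `hasMajorant_commStep_member_rate` from p21 D3's cube datum `hR`), composed by FILE 4's
engine (`mul_decay_majorant_blk`, [4] (2.60)–(2.61)).

WHAT THIS FILE CERTIFIES (kernel-checked; 0 `def`, 0 `def … : Prop`, 0 sorry)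

§1 `GpCubeY_mul_cutMulY_eq_at`, `cutMulY_mul_GpCubeY_eq_at` — the two identities above at the datum.
§2 ★★★ `hasMajorant_rightEntry_at` — FILE 7's `hRop □ ν`: `conj((η²G′_□(V′))^ℝ)·M_{χl}♯·conj(−η⁻¹∇*_ν(U₁)) ≺ κ_R·ℓ(a)·e^{−ρδ₀d}`,
   `κ_R = (K₁ + K₂)(1 + θ_KΛc₁)`, `K₁ = M₂Σ‖b_j‖B_G`, `K₂ = M₂Σ‖b_j‖B_GΛD₁θ∕3`, from `hE`, `hGK`, `hT1`, the member (2.61), budgets `ρ ≤ a_G − α`, `ρ + α + β ≤ b_K`;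
   ★★ `hasMajorant_mul_rightEntry_at` — the prefixed twin `T·(right entry) ≺ ((κ₁ + κ₂)(K₁ + K₂)Λc₁)·(w₁ℓ)(a)·e^{−ρδ₀d}` from `T·M_{χ_□}♯ ≺ κ₁w₁e^{−r₁d}`,
   `T·conj((G′_□K_χ)(V′)^ℝ) ≺ κ₂w₁e^{−r₁d}` (for FILE 7's `hGw □ ν` with `T = conj(sS_□(V′))`, next file).
§3 ★★★ `hasMajorant_leftEntry_at` — FILE 7's `hLw □ μ`: `conj(η⁻¹∇_μ(U₁))·M_{χl}♯·conj((η²G′_□(V′))^ℝ) ≺ 𝟙[a ∈ S_L]·κ_L·ℓ(a)·e^{−ρδ₀d}`, rows located in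
   `S_L = {blocks meeting NearC(21S_j∕8 + 1)}`, `κ_L = (K₁ + |η⁻¹|(D₁θ∕(3S_j))(S_jη_k)K₀)(1 + (M₂Σ)²θc₁(dB_c)·c₁)`, from `hE`, p21 D3's `hR`, the cube and member (2.61).

HONEST SCOPE ∕ NOT CLAIMED.  Finite lattice algebra and [4]'s bookkeeping over landed modules; the (3.42) block `hE`, the kernels `hGK` (member carrier) and `hR` (cube
carrier), the units and the datum are displayed; NO inequality of [B9] is proved here beyond them; NOT a node discharge; nothing continuum ∕ OS ∕ mass-gap ∕ Clay; YM mass gap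
NOT proved (Track A conditional rung).  No `sorry`, no `axiom`, no `… : Prop` fact, no `instance`, no `notation`, no `def`.  NEW file; nothing landed is modified.
Cell `lit-balaban`, seat `lit-balaban-p33` gen 104, 2026-08-29; `--supports stmt-QuantumFields-19200` as helper.  Net new unproved facts: 0.

RELATED IN THE TREE, NOT DUPLICATED (searched 2026-08-29: `rg 'rightEntry_at|leftEntry_at' Literature/` = ∅): p38 `B9Eq3105FamThreeLocDiffGRight` (the `(G′ − G′_□)` right
entry; its §3 pieces USED BY NAME), p33 `B9Eq3105FamThreeLocDiffGAssembly` ∕ `…Engine` (left twin; engine USED BY NAME), `B9Eq3105FamThreeLocDiffG` (identities),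
`B9Eq3105FamThreeLocDiffGOfEBlock` (`hasMajorant_commStep_member_rate`), `B9CubeLettersInvReadDict` (entries of `hE`), FILE 4 `B9Eq3105FamThreeLocCDiffChains`.
-/

noncomputable section

namespace Literature.MathematicalPhysics.QuantumFieldTheory.Balaban1983to89.B9Eq3105FamThreeLocCDiffOuterEntries

open NormedSpace Complex
open B6RandomWalk (HasMajorant hasMajorant_mono hasMajorant_add Ineq261 c1_nonneg Triangle254)
open B6DomainMajorant (hasMajorant_sub)
open B9Thm34Ext (toB6)
open B9Thm37Sum (mulOp mulOp_apply)
open B9FromB6 (EBlock)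
open B9Ineq347 (ScaleTransfer)
open B9Eq352DivFormLetters (conj)
open B9Eq352GradLetters (diffLetter)
open B9Eq39Adjoint (fluct)
open B9Eq360DeltaPrimeAY (AfldY)
open B9Eq360DeltaPrimeACubeY (blkCubeY)
open B4PartitionUnity22 (thetaProf D1 D1_nonneg contDiff_thetaProf hasCompactSupport_thetaProf)
open B6KLevelCensusIndexV1 (KIdx kGeo)
open B6Cover236MultiLevelBlocks (cubes)
open B6GlobalChartV1 (PV boxEquiv)
open B6Geom246MultiLevelBox (blkOf)
open B6Ineq2142KLevelV1 (β)
open B9GeoNormsKLevelV1 (geo9K)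
open B9GeoLemma21KLevelV1 (geo9K_len_pos)
open B9CubeGeometryInputs (geoCK)
open B9CubeLettersOpsL0 (deltaPrimeACubeY GpCubeY)
open B9CubeLettersInvReadings (kernelFamilySInv)
open B9CubeLettersInvReadDict (hasMajorant_conj_G_of_eBlockInv hasMajorant_gradF_mul_G_of_eBlockInv)
open B9Thm37CubeCoverCommutators (cutMulY cutMulY_apply)
open B9Thm39CinvTorusRegular (conj_cutMulY)
open B9Eq395Small (hasMajorant_mulOp_left hasMajorant_mul_mulOp_right)
open B9Cor36CutoffField337 (bumpY)
open B9Cor36CubeCutoffs (SC NearC chiY ctrR locCfgY one_le_SC pow_levY_le_SC abs_chiY_le_one)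
open B9Cor36CubeTwinsGeometry (bS)
open B9Cor36SiteSandwichTransfer (geo9K_len_site)
open B9Cor36CollarSeparation (chiL_mul_chiY nearC_of_chiL_ne_zero)
open B9ThmDCubePlateau (comm_cutMulY_chiY_deltaPrimeACubeY)
open B9Eq3105FamTwoCore (geo9K_axioms)
open B9Eq3105FamThreeCommStepMember (hasMajorant_conj_commStep_member)
open B9Eq3105FamThreeLocDiffG (GpY_sub_GpCubeY_cutMulY_eq_at cutMulY_GpY_sub_GpCubeY_eq_at)
open B9Eq3105FamThreeLocDiffGEngine (hasMajorant_leftFactor conj_diffLetter_mul_cutMulY)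
open B9Eq3105FamThreeLocDiffGAssembly (three_SC_pos abs_chiL_le_one nearC_of_chiL_shiftY_ne_zero abs_chiL_shiftY_sub_le)
open B9Eq3105FamThreeLocDiffGRight (conj_cut_gradB_split hasMajorant_colL_G_gradB hasMajorant_colL_G_dchi)
open B9Eq3105FamThreeLocDiffGOfEBlock (hasMajorant_commStep_member_rate restrict_smul_apply)
open B9Eq3105FamThreeLocCDiffChains (mul_decay_majorant_blk chain_majorant_blk)
open B9Ineq366CPrime (scaleTransfer_one)
open Node00 (SiteY BlkY IBondY CfgY GaugeY toKT shiftY UboxY GpY deltaPrimeAY gaugeY parSymY etaS)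

variable {d ℓ : ℕ} {hd : 1 ≤ d + 1} {hL : Odd (ℓ + 1) ∧ 1 < ℓ + 1} {b₀ b₁ : ℝ}
variable {𝔸 : Type} [NormedRing 𝔸] [NormedAlgebra ℂ 𝔸] [CompleteSpace 𝔸]
variable {ι : Type} [Fintype ι]
variable (i : KIdx d ℓ hd hL b₀ b₁) (c : ↥(cubes (toKT i).D.toDomains)) (b : Module.Basis ι ℝ 𝔸)

/-! ## §1  The one-sided identities at the datum: the cube letter through the member letter -/

section Identities

/-- ★ **`G′_□(V′)·M_{χl} = (M_{χ_□} − G′_□(V′)·(Δ′_□M_{χ_□} − M_{χ_□}Δ′_□)(V′))·G′(U)·M_{χl}`** at the (3.35) datum (F3-E1's right identity solved for the cube letter).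
[cite: Balaban1985BackgroundPropagators, (3.95)∕(3.97) pp.411–412, p.415 l.29–31, (3.88) p.409] -/
theorem GpCubeY_mul_cutMulY_eq_at (g : GaugeY 𝔸 i) (U : CfgY 𝔸 i) {Q : Set (Site (PV d ℓ i.m i.K hd hL) 0)} (η : ℝ) (A : AfldY 𝔸 i)
    (hQ : ∀ x : Site (PV d ℓ i.m i.K hd hL) 0, NearC i c (35 * SC i c / 8 + 1) (boxEquiv i.hN x).1 → x ∈ Q)
    (hgA : ∀ (κ : Fin (d + 1)) (x : Site (PV d ℓ i.m i.K hd hL) 0), x ∈ Q → x.shift κ ∈ Q → gaugeY i g U κ x = fluct η A κ x)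
    (hU : IsUnit (deltaPrimeAY i (parSymY i) U)) (hV : IsUnit (deltaPrimeACubeY i c (parSymY i) (gaugeY i g⁻¹ (locCfgY i c η A)))) :
    GpCubeY i c (parSymY i) (gaugeY i g⁻¹ (locCfgY i c η A)) * cutMulY (𝔸 := 𝔸) (bumpY i (ctrR i c) (3 * (SC i c : ℝ))) =
      (cutMulY (𝔸 := 𝔸) (chiY i c) -
          GpCubeY i c (parSymY i) (gaugeY i g⁻¹ (locCfgY i c η A)) *
            (deltaPrimeACubeY i c (parSymY i) (gaugeY i g⁻¹ (locCfgY i c η A)) * cutMulY (𝔸 := 𝔸) (chiY i c) -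
              cutMulY (𝔸 := 𝔸) (chiY i c) * deltaPrimeACubeY i c (parSymY i) (gaugeY i g⁻¹ (locCfgY i c η A)))) *
        GpY i (parSymY i) U * cutMulY (𝔸 := 𝔸) (bumpY i (ctrR i c) (3 * (SC i c : ℝ))) := by
  set V' := gaugeY i g⁻¹ (locCfgY i c η A) with hV'
  have hK : deltaPrimeACubeY i c (parSymY i) V' * cutMulY (𝔸 := 𝔸) (chiY i c) - cutMulY (𝔸 := 𝔸) (chiY i c) * deltaPrimeACubeY i c (parSymY i) V' =
      -B9Thm37CubeCoverCommutators.KhY i (parSymY i) (chiY i c) V' := by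
    rw [← comm_cutMulY_chiY_deltaPrimeACubeY i c V', neg_sub]
  have h := GpY_sub_GpCubeY_cutMulY_eq_at i c g U η A hQ hgA hU hV (bumpY i (ctrR i c) (3 * (SC i c : ℝ))) (chiL_mul_chiY i c)
  rw [hK]
  set Ac := GpY i (parSymY i) U
  set Bc := GpCubeY i c (parSymY i) V'
  set Ml := cutMulY (𝔸 := 𝔸) (bumpY i (ctrR i c) (3 * (SC i c : ℝ)))
  set Mc := cutMulY (𝔸 := 𝔸) (chiY i c)
  set Kh := B9Thm37CubeCoverCommutators.KhY i (parSymY i) (chiY i c) V'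
  have h2 : Bc * Ml = Ac * Ml - (Ac - Bc) * Ml := by rw [sub_mul]; abel
  rw [h2, h]
  simp only [sub_mul, one_mul, mul_assoc]
  abel

/-- ★ **`M_{χl}·G′_□(V′) = M_{χl}·G′(U)·(M_{χ_□} − (M_{χ_□}Δ′_□ − Δ′_□M_{χ_□})(V′)G′_□(V′))`** at the datum (F3-E1's left identity solved for the cube letter).
[cite: Balaban1985BackgroundPropagators, (3.95)∕(3.97) pp.411–412, p.415 l.29–31, (3.88) p.409] -/
theorem cutMulY_mul_GpCubeY_eq_at (g : GaugeY 𝔸 i) (U : CfgY 𝔸 i) {Q : Set (Site (PV d ℓ i.m i.K hd hL) 0)} (η : ℝ) (A : AfldY 𝔸 i)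
    (hQ : ∀ x : Site (PV d ℓ i.m i.K hd hL) 0, NearC i c (35 * SC i c / 8 + 1) (boxEquiv i.hN x).1 → x ∈ Q)
    (hgA : ∀ (κ : Fin (d + 1)) (x : Site (PV d ℓ i.m i.K hd hL) 0), x ∈ Q → x.shift κ ∈ Q → gaugeY i g U κ x = fluct η A κ x)
    (hU : IsUnit (deltaPrimeAY i (parSymY i) U)) (hV : IsUnit (deltaPrimeACubeY i c (parSymY i) (gaugeY i g⁻¹ (locCfgY i c η A)))) :
    cutMulY (𝔸 := 𝔸) (bumpY i (ctrR i c) (3 * (SC i c : ℝ))) * GpCubeY i c (parSymY i) (gaugeY i g⁻¹ (locCfgY i c η A)) =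
      cutMulY (𝔸 := 𝔸) (bumpY i (ctrR i c) (3 * (SC i c : ℝ))) * GpY i (parSymY i) U *
        (cutMulY (𝔸 := 𝔸) (chiY i c) -
          (cutMulY (𝔸 := 𝔸) (chiY i c) * deltaPrimeACubeY i c (parSymY i) (gaugeY i g⁻¹ (locCfgY i c η A)) -
              deltaPrimeACubeY i c (parSymY i) (gaugeY i g⁻¹ (locCfgY i c η A)) * cutMulY (𝔸 := 𝔸) (chiY i c)) *
            GpCubeY i c (parSymY i) (gaugeY i g⁻¹ (locCfgY i c η A))) := by
  set V' := gaugeY i g⁻¹ (locCfgY i c η A) with hV'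
  rw [comm_cutMulY_chiY_deltaPrimeACubeY i c V']
  have h := cutMulY_GpY_sub_GpCubeY_eq_at i c g U η A hQ hgA hU hV (bumpY i (ctrR i c) (3 * (SC i c : ℝ))) (chiL_mul_chiY i c)
  set Ac := GpY i (parSymY i) U
  set Bc := GpCubeY i c (parSymY i) V'
  set Ml := cutMulY (𝔸 := 𝔸) (bumpY i (ctrR i c) (3 * (SC i c : ℝ)))
  set Mc := cutMulY (𝔸 := 𝔸) (chiY i c)
  set Kh := B9Thm37CubeCoverCommutators.KhY i (parSymY i) (chiY i c) V'
  have h2 : Ml * Bc = Ml * Ac - Ml * (Ac - Bc) := by rw [mul_sub]; abel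
  rw [h2, h]
  simp only [mul_sub, mul_one, mul_assoc]
  abel

end Identities

/-! ## §2  The right entry `conj(η²G′_□(V′))·M_{χl}·conj(−η⁻¹∇*_ν)` (FILE 7's `hRop □ ν`) -/

section Right

variable [Fintype (geo9K i).Site] [DecidableEq (geo9K i).Site] {Rr' : ℝ} {Hp : Prop}
variable {B : B9.Backgrounds} (cfg : B.Cfg → CfgY 𝔸 i) {U₁ : B.Cfg}

open Classical in
set_option maxHeartbeats 3200000 in
/-- ★★★ **FILE 7's `hRop □ ν` FROM `hE` AND `hGK`**: `conj((η²G′_□(V′))^ℝ)·M_{χl}♯·conj(−η⁻¹∇*_ν(U₁)) ≺ ((K₁ + K₂)(1 + θ_KΛc₁(dB, δ₀, β)))·ℓ(a)·e^{−ρδ₀d}`,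
`K₁ = M₂Σ‖b_j‖B_G`, `K₂ = M₂Σ‖b_j‖B_GΛD₁θ∕3` — §1's right identity, p38's (3.100) split and column pieces, the kernel `hGK`, FILE 4's chain.
[cite: Balaban1985BackgroundPropagators, p.415 l.29–31, p.412 l.22–36, (3.97) p.412, (3.100) p.413, Thm 3.1 (3.42) p.397, (3.88)–(3.89) p.409; Balaban1983RegularityDecay, (1.11)–(1.12) (statement type); Balaban1984PropagatorsII, (2.51)–(2.52) p.232, Lemma 2.1 (2.60)–(2.61) p.234] -/
theorem hasMajorant_rightEntry_at {BG δG : ℝ} (hE : EBlock (kernelFamilySInv i B cfg (fun W => GpY i (parSymY i) W) (parSymY i)) BG δG U₁) (hBG : 0 ≤ BG)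
    (ιB : BlkY i → IBondY i) (hι : ∀ s, β i.hN i.D i.hk (ιB s) = s)
    {M₂ : ℝ} (hM₂ : 0 ≤ M₂) (hrepr : ∀ (v : 𝔸) (j : ι), |b.repr v j| ≤ M₂ * ‖v‖) (hη : etaS i = |i.cf|⁻¹) (ν : Fin (d + 1))
    (g : GaugeY 𝔸 i) (η : ℝ) (A : AfldY 𝔸 i) {Q : Set (Site (PV d ℓ i.m i.K hd hL) 0)}
    (hQ : ∀ x : Site (PV d ℓ i.m i.K hd hL) 0, NearC i c (35 * SC i c / 8 + 1) (boxEquiv i.hN x).1 → x ∈ Q)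
    (hgA : ∀ (κ : Fin (d + 1)) (x : Site (PV d ℓ i.m i.K hd hL) 0), x ∈ Q → x.shift κ ∈ Q → gaugeY i g (cfg U₁) κ x = fluct η A κ x)
    (hU : IsUnit (deltaPrimeAY i (parSymY i) (cfg U₁))) (hV : IsUnit (deltaPrimeACubeY i c (parSymY i) (gaugeY i g⁻¹ (locCfgY i c η A))))
    (dB : ℕ) {δ₀ aG α Λ θK bK ρ β' : ℝ} (hδ₀ : 0 ≤ δ₀) (haG : aG * δ₀ ≤ δG) (hα : 0 ≤ α) (hΛ : 0 ≤ Λ)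
    (hT1 : ScaleTransfer (geo9K i) δ₀ α Λ (fun a => (geo9K i).len a)) (hθK : 0 ≤ θK) (hρ : 0 ≤ ρ) (hρG : ρ ≤ aG - α) (hρK : ρ + (α + β') ≤ bK)
    (h261 : Ineq261 dB (toB6 (geo9K i) Rr' Hp) δ₀ β')
    (hGK : HasMajorant (g := toB6 (geo9K i) Rr' Hp) (fun p : SiteY i × ι => ιB (blkOf i.D.toDomains p.1))
      (conj b (((GpCubeY i c (parSymY i) (gaugeY i g⁻¹ (locCfgY i c η A)) *
          (deltaPrimeACubeY i c (parSymY i) (gaugeY i g⁻¹ (locCfgY i c η A)) * cutMulY (𝔸 := 𝔸) (chiY i c) -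
            cutMulY (𝔸 := 𝔸) (chiY i c) * deltaPrimeACubeY i c (parSymY i) (gaugeY i g⁻¹ (locCfgY i c η A)))).restrictScalars ℝ :
        Module.End ℝ (SiteY i → 𝔸))))
      (fun (a y'' : (geo9K i).Site) => θK * Real.exp (-(bK * δ₀ * (geo9K i).dist a y'')))) :
    HasMajorant (g := toB6 (geo9K i) Rr' Hp) (fun p : SiteY i × ι => ιB (blkOf i.D.toDomains p.1))
      (conj b (((((etaS i ^ 2 : ℝ) : ℂ)) • GpCubeY i c (parSymY i) (gaugeY i g⁻¹ (locCfgY i c η A))).restrictScalars ℝ) *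
        mulOp (fun p : SiteY i × ι => bumpY i (ctrR i c) (3 * (SC i c : ℝ)) p.1) *
        conj b (diffLetter (shiftY i) (UboxY i (cfg U₁)) (((etaS i : ℝ) : ℂ))⁻¹ (Sum.inr ν)))
      (fun a a' => ((M₂ * (∑ j, ‖b j‖) * BG + M₂ * (∑ j, ‖b j‖) * BG * Λ * (D1 thetaProf / 3)) * (1 + θK * Λ * B6.c1 dB δ₀ β')) *
        (geo9K i).len a * Real.exp (-(ρ * δ₀ * (geo9K i).dist a a'))) := by
  obtain ⟨htri, hsymm, hdnn⟩ := geo9K_axioms i Rr' Hp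
  have hSb : 0 ≤ ∑ j, ‖b j‖ := Finset.sum_nonneg fun _ _ => norm_nonneg _
  have hD1 : 0 ≤ D1 thetaProf := D1_nonneg contDiff_thetaProf hasCompactSupport_thetaProf
  have hlen0 : ∀ y : (geo9K i).Site, 0 ≤ (geo9K i).len y := fun y => (geo9K_len_pos i y).le
  have hc1 : 0 ≤ B6.c1 dB δ₀ β' := c1_nonneg _ _ _
  set V' : CfgY 𝔸 i := gaugeY i g⁻¹ (locCfgY i c η A) with hV'
  set χl : SiteY i → ℝ := bumpY i (ctrR i c) (3 * (SC i c : ℝ)) with hχl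
  set blk : SiteY i × ι → (geo9K i).Site := fun p => ιB (blkOf i.D.toDomains p.1) with hblk
  set Ac : (SiteY i → 𝔸) →ₗ[ℂ] (SiteY i → 𝔸) := GpY i (parSymY i) (cfg U₁) with hAc
  set Bc : (SiteY i → 𝔸) →ₗ[ℂ] (SiteY i → 𝔸) := GpCubeY i c (parSymY i) V' with hBc
  set GK : (SiteY i → 𝔸) →ₗ[ℂ] (SiteY i → 𝔸) := Bc * (deltaPrimeACubeY i c (parSymY i) V' * cutMulY (𝔸 := 𝔸) (chiY i c) -
    cutMulY (𝔸 := 𝔸) (chiY i c) * deltaPrimeACubeY i c (parSymY i) V') with hGKdef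
  set Y : (SiteY i → 𝔸) →ₗ[ℂ] (SiteY i → 𝔸) := cutMulY (𝔸 := 𝔸) (chiY i c) - GK with hY
  set Dr : Module.End ℝ (SiteY i × ι → ℝ) := conj b (diffLetter (shiftY i) (UboxY i (cfg U₁)) (((etaS i : ℝ) : ℂ))⁻¹ (Sum.inr ν)) with hDr
  -- §1's identity, and the operator in p38's split shape
  have hid : Bc * cutMulY (𝔸 := 𝔸) χl = (Y ∘ₗ Ac) ∘ₗ cutMulY (𝔸 := 𝔸) χl := by
    rw [hBc, hY, hGKdef, hBc, hAc, hχl, hV', GpCubeY_mul_cutMulY_eq_at i c g (cfg U₁) η A hQ hgA hU hV]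
    rfl
  have e1 : conj b (((((etaS i ^ 2 : ℝ) : ℂ)) • Bc).restrictScalars ℝ) * mulOp (fun p : SiteY i × ι => χl p.1) =
      conj b (((etaS i ^ 2) • ((Y ∘ₗ Ac) ∘ₗ cutMulY (𝔸 := 𝔸) χl)).restrictScalars ℝ) := by
    rw [← conj_cutMulY b χl, ← B9Eq352DivFormLetters.conj_mul]
    refine congrArg (conj b) (LinearMap.ext fun Λ => ?_)
    have h1 : Bc (cutMulY (𝔸 := 𝔸) χl Λ) = Y (Ac (cutMulY (𝔸 := 𝔸) χl Λ)) := by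
      have := congrArg (fun T : (SiteY i → 𝔸) →ₗ[ℂ] (SiteY i → 𝔸) => T Λ) hid
      simpa only [Module.End.mul_apply, LinearMap.coe_comp, Function.comp_apply] using this
    simp only [Module.End.mul_apply, LinearMap.restrictScalars_apply, LinearMap.smul_apply, LinearMap.coe_comp, Function.comp_apply, h1]
    exact algebraMap_smul ℂ (etaS i ^ 2) (Y (Ac (cutMulY (𝔸 := 𝔸) χl Λ)))
  rw [e1, conj_cut_gradB_split i b (cfg U₁) (etaS i) ν χl Y Ac]
  -- the two column pieces from `hE`, indicators dropped, rates relaxed to `ρδ₀`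
  have hρaG : ρ * δ₀ ≤ (aG - α) * δ₀ := mul_le_mul_of_nonneg_right hρG hδ₀
  have hρδG : ρ * δ₀ ≤ δG := by nlinarith [mul_nonneg hα hδ₀]
  have hP1 : HasMajorant (g := toB6 (geo9K i) Rr' Hp) blk
      (conj b (((etaS i ^ 2) • Ac).restrictScalars ℝ) * Dr * mulOp (fun p : SiteY i × ι => χl (shiftY i ν p.1)))
      (fun (a b' : (geo9K i).Site) => (M₂ * (∑ j, ‖b j‖) * BG) * (geo9K i).len a * Real.exp (-(ρ * δ₀ * (geo9K i).dist a b'))) := by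
    refine hasMajorant_mono (g := toB6 (geo9K i) Rr' Hp) _
      (hasMajorant_colL_G_gradB i c b cfg (fun W => GpY i (parSymY i) W) (parSymY i) (Rr := Rr') (Hp := Hp) hE hBG ιB hι hM₂ hrepr ν) fun a b' => ?_
    have hnn : 0 ≤ M₂ * (∑ j, ‖b j‖) * BG * (geo9K i).len a * Real.exp (-(δG * (geo9K i).dist a b')) := by
      have := hlen0 a; positivity
    refine le_trans (mul_le_of_le_one_left hnn (by split_ifs <;> norm_num)) ?_
    exact mul_le_mul_of_nonneg_left (Real.exp_le_exp.2 (neg_le_neg (mul_le_mul_of_nonneg_right hρδG (hdnn a b')))) (by have := hlen0 a; positivity)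
  have hP2 : HasMajorant (g := toB6 (geo9K i) Rr' Hp) blk
      (conj b (((etaS i ^ 2) • Ac).restrictScalars ℝ) * mulOp (fun p : SiteY i × ι => (etaS i)⁻¹ * (χl p.1 - χl (shiftY i ν p.1))))
      (fun (a b' : (geo9K i).Site) => (M₂ * (∑ j, ‖b j‖) * BG * Λ * (D1 thetaProf / 3)) * (geo9K i).len a * Real.exp (-(ρ * δ₀ * (geo9K i).dist a b'))) := by
    refine hasMajorant_mono (g := toB6 (geo9K i) Rr' Hp) _
      (hasMajorant_colL_G_dchi i c b cfg (fun W => GpY i (parSymY i) W) (parSymY i) (Rr := Rr') (Hp := Hp) hE hBG ιB hι hM₂ hrepr hη ν haG hΛ hT1)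
      fun a b' => ?_
    have hnn : 0 ≤ M₂ * (∑ j, ‖b j‖) * BG * Λ * (D1 thetaProf / 3) * (geo9K i).len a * Real.exp (-((aG - α) * δ₀ * (geo9K i).dist a b')) := by
      have := hlen0 a; positivity
    refine le_trans (mul_le_of_le_one_left hnn (by split_ifs <;> norm_num)) ?_
    exact mul_le_mul_of_nonneg_left (Real.exp_le_exp.2 (neg_le_neg (mul_le_mul_of_nonneg_right hρaG (hdnn a b')))) (by have := hlen0 a; positivity)
  -- their sum `P`
  set P : Module.End ℝ (SiteY i × ι → ℝ) := conj b (((etaS i ^ 2) • Ac).restrictScalars ℝ) * Dr * mulOp (fun p : SiteY i × ι => χl (shiftY i ν p.1)) +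
    conj b (((etaS i ^ 2) • Ac).restrictScalars ℝ) * mulOp (fun p : SiteY i × ι => (etaS i)⁻¹ * (χl p.1 - χl (shiftY i ν p.1))) with hPdef
  have hP : HasMajorant (g := toB6 (geo9K i) Rr' Hp) blk P
      (fun (a b' : (geo9K i).Site) => (M₂ * (∑ j, ‖b j‖) * BG + M₂ * (∑ j, ‖b j‖) * BG * Λ * (D1 thetaProf / 3)) * (geo9K i).len a *
        Real.exp (-(ρ * δ₀ * (geo9K i).dist a b'))) :=
    hasMajorant_mono (g := toB6 (geo9K i) Rr' Hp) _ (hasMajorant_add (g := toB6 (geo9K i) Rr' Hp) blk hP1 hP2) fun a b' => le_of_eq (by ring)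
  -- the prefactor `conj(Y^ℝ) = M_{χ_□}♯ − conj(GK^ℝ)`
  have eY : conj b (Y.restrictScalars ℝ) = mulOp (fun p : SiteY i × ι => chiY i c p.1) - conj b (GK.restrictScalars ℝ) := by
    rw [hY, show ((cutMulY (𝔸 := 𝔸) (chiY i c) - GK).restrictScalars ℝ : Module.End ℝ (SiteY i → 𝔸)) =
      (cutMulY (𝔸 := 𝔸) (chiY i c)).restrictScalars ℝ - GK.restrictScalars ℝ from LinearMap.ext fun _ => rfl, B9Eq352DivFormLetters.conj_sub, conj_cutMulY]
  have eop : conj b (Y.restrictScalars ℝ) * (conj b (((etaS i ^ 2) • Ac).restrictScalars ℝ) * Dr) * mulOp (fun p : SiteY i × ι => χl (shiftY i ν p.1)) +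
        conj b (Y.restrictScalars ℝ) * conj b (((etaS i ^ 2) • Ac).restrictScalars ℝ) *
          mulOp (fun p : SiteY i × ι => (etaS i)⁻¹ * (χl p.1 - χl (shiftY i ν p.1))) =
      mulOp (fun p : SiteY i × ι => chiY i c p.1) * P - conj b (GK.restrictScalars ℝ) * P := by
    rw [eY, hPdef]
    simp only [sub_mul, mul_add, mul_assoc]
    abel
  rw [eop]
  have hK0 : 0 ≤ M₂ * (∑ j, ‖b j‖) * BG + M₂ * (∑ j, ‖b j‖) * BG * Λ * (D1 thetaProf / 3) := by positivity
  -- `M_{χ_□}♯·P`: the multiplier costs nothing; `conj(GK)·P`: FILE 4's chain with the kernel `hGK`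
  have h1 := hasMajorant_mulOp_left (G := toB6 (geo9K i) Rr' Hp) blk hP (fun p : SiteY i × ι => chiY i c p.1) fun p => (abs_chiY_le_one i c p.1).1
  have hGK' : HasMajorant (g := toB6 (geo9K i) Rr' Hp) blk (conj b (GK.restrictScalars ℝ))
      (fun (a b' : (geo9K i).Site) => θK * (fun _ : (geo9K i).Site => (1 : ℝ)) a * Real.exp (-(bK * δ₀ * (geo9K i).dist a b'))) :=
    hasMajorant_mono (g := toB6 (geo9K i) Rr' Hp) _ hGK fun a b' => le_of_eq (by simp only [mul_one])
  have h2 := mul_decay_majorant_blk (Rg := Rr') (Hg := Hp) blk dB (fun _ : (geo9K i).Site => (1 : ℝ)) (fun a => (geo9K i).len a) hθK hK0 hΛ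
    (fun _ => zero_le_one) hlen0 (by positivity : 0 ≤ ρ * δ₀)
    (by nlinarith [mul_le_mul_of_nonneg_right hρK hδ₀] : ρ * δ₀ + (α + β') * δ₀ ≤ bK * δ₀) hdnn htri hT1 h261 hGK' hP
  refine hasMajorant_mono (g := toB6 (geo9K i) Rr' Hp) _ (hasMajorant_sub (g := toB6 (geo9K i) Rr' Hp) blk h1 h2) fun a b' => le_of_eq ?_
  ring

open Classical in
set_option maxHeartbeats 3200000 in
/-- ★★ **A PREFIXED RIGHT ENTRY `T·conj(η²G′_□(V′))·M_{χl}·conj(−η⁻¹∇*_ν)`** (for FILE 7's `hGw □ ν`, `T = conj(sS_□(V′))`): if `T·M_{χ_□}♯ ≺ κ₁w₁(a)e^{−r₁d}` and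
`T·conj((G′_□K_χ)(V′)^ℝ) ≺ κ₂w₁(a)e^{−r₁d}` with `ρδ₀ + (α + β)δ₀ ≤ r₁`, then `T·(right entry) ≺ ((κ₁ + κ₂)(K₁ + K₂)Λc₁)·(w₁ℓ)(a)·e^{−ρδ₀d}` — the same split, the
prefix absorbed into the two chains (the cube kernel `hGK` itself is not needed here: it enters through the displayed `T·conj((G′_□K_χ)^ℝ)`).
[cite: Balaban1985BackgroundPropagators, p.415 l.29–31, p.412 l.22–36, (3.97) p.412, (3.100) p.413, Thm 3.1 (3.42) p.397, (3.88)–(3.89) p.409; Balaban1983RegularityDecay, (1.11)–(1.12) (statement type); Balaban1984PropagatorsII, (2.51)–(2.52) p.232, Lemma 2.1 (2.60)–(2.61) p.234] -/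
theorem hasMajorant_mul_rightEntry_at {BG δG : ℝ} (hE : EBlock (kernelFamilySInv i B cfg (fun W => GpY i (parSymY i) W) (parSymY i)) BG δG U₁) (hBG : 0 ≤ BG)
    (ιB : BlkY i → IBondY i) (hι : ∀ s, β i.hN i.D i.hk (ιB s) = s)
    {M₂ : ℝ} (hM₂ : 0 ≤ M₂) (hrepr : ∀ (v : 𝔸) (j : ι), |b.repr v j| ≤ M₂ * ‖v‖) (hη : etaS i = |i.cf|⁻¹) (ν : Fin (d + 1))
    (g : GaugeY 𝔸 i) (η : ℝ) (A : AfldY 𝔸 i) {Q : Set (Site (PV d ℓ i.m i.K hd hL) 0)}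
    (hQ : ∀ x : Site (PV d ℓ i.m i.K hd hL) 0, NearC i c (35 * SC i c / 8 + 1) (boxEquiv i.hN x).1 → x ∈ Q)
    (hgA : ∀ (κ : Fin (d + 1)) (x : Site (PV d ℓ i.m i.K hd hL) 0), x ∈ Q → x.shift κ ∈ Q → gaugeY i g (cfg U₁) κ x = fluct η A κ x)
    (hU : IsUnit (deltaPrimeAY i (parSymY i) (cfg U₁))) (hV : IsUnit (deltaPrimeACubeY i c (parSymY i) (gaugeY i g⁻¹ (locCfgY i c η A))))
    (dB : ℕ) {δ₀ aG α Λ ρ β' : ℝ} (hδ₀ : 0 ≤ δ₀) (haG : aG * δ₀ ≤ δG) (hα : 0 ≤ α) (hΛ : 0 ≤ Λ)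
    (hT1 : ScaleTransfer (geo9K i) δ₀ α Λ (fun a => (geo9K i).len a)) (hρ : 0 ≤ ρ) (hρG : ρ ≤ aG - α)
    (h261 : Ineq261 dB (toB6 (geo9K i) Rr' Hp) δ₀ β')
    {T : Module.End ℝ (SiteY i × ι → ℝ)} {κ₁ κ₂ r₁ : ℝ} (w₁ : (geo9K i).Site → ℝ) (hκ₁ : 0 ≤ κ₁) (hκ₂ : 0 ≤ κ₂) (hw₁ : ∀ a, 0 ≤ w₁ a)
    (hr₁ : ρ * δ₀ + (α + β') * δ₀ ≤ r₁)
    (hTM : HasMajorant (g := toB6 (geo9K i) Rr' Hp) (fun p : SiteY i × ι => ιB (blkOf i.D.toDomains p.1))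
      (T * mulOp (fun p : SiteY i × ι => chiY i c p.1)) (fun (a a' : (geo9K i).Site) => κ₁ * w₁ a * Real.exp (-(r₁ * (geo9K i).dist a a'))))
    (hTK : HasMajorant (g := toB6 (geo9K i) Rr' Hp) (fun p : SiteY i × ι => ιB (blkOf i.D.toDomains p.1))
      (T * conj b (((GpCubeY i c (parSymY i) (gaugeY i g⁻¹ (locCfgY i c η A)) *
          (deltaPrimeACubeY i c (parSymY i) (gaugeY i g⁻¹ (locCfgY i c η A)) * cutMulY (𝔸 := 𝔸) (chiY i c) -
            cutMulY (𝔸 := 𝔸) (chiY i c) * deltaPrimeACubeY i c (parSymY i) (gaugeY i g⁻¹ (locCfgY i c η A)))).restrictScalars ℝ :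
        Module.End ℝ (SiteY i → 𝔸))))
      (fun (a a' : (geo9K i).Site) => κ₂ * w₁ a * Real.exp (-(r₁ * (geo9K i).dist a a')))) :
    HasMajorant (g := toB6 (geo9K i) Rr' Hp) (fun p : SiteY i × ι => ιB (blkOf i.D.toDomains p.1))
      (T * (conj b (((((etaS i ^ 2 : ℝ) : ℂ)) • GpCubeY i c (parSymY i) (gaugeY i g⁻¹ (locCfgY i c η A))).restrictScalars ℝ) *
        mulOp (fun p : SiteY i × ι => bumpY i (ctrR i c) (3 * (SC i c : ℝ)) p.1) *
        conj b (diffLetter (shiftY i) (UboxY i (cfg U₁)) (((etaS i : ℝ) : ℂ))⁻¹ (Sum.inr ν))))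
      (fun a a' => ((κ₁ + κ₂) * (M₂ * (∑ j, ‖b j‖) * BG + M₂ * (∑ j, ‖b j‖) * BG * Λ * (D1 thetaProf / 3)) * Λ * B6.c1 dB δ₀ β') *
        (w₁ a * (geo9K i).len a) * Real.exp (-(ρ * δ₀ * (geo9K i).dist a a'))) := by
  obtain ⟨htri, hsymm, hdnn⟩ := geo9K_axioms i Rr' Hp
  have hSb : 0 ≤ ∑ j, ‖b j‖ := Finset.sum_nonneg fun _ _ => norm_nonneg _
  have hD1 : 0 ≤ D1 thetaProf := D1_nonneg contDiff_thetaProf hasCompactSupport_thetaProf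
  have hlen0 : ∀ y : (geo9K i).Site, 0 ≤ (geo9K i).len y := fun y => (geo9K_len_pos i y).le
  have hc1 : 0 ≤ B6.c1 dB δ₀ β' := c1_nonneg _ _ _
  set V' : CfgY 𝔸 i := gaugeY i g⁻¹ (locCfgY i c η A) with hV'
  set χl : SiteY i → ℝ := bumpY i (ctrR i c) (3 * (SC i c : ℝ)) with hχl
  set blk : SiteY i × ι → (geo9K i).Site := fun p => ιB (blkOf i.D.toDomains p.1) with hblk
  set Ac : (SiteY i → 𝔸) →ₗ[ℂ] (SiteY i → 𝔸) := GpY i (parSymY i) (cfg U₁) with hAc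
  set Bc : (SiteY i → 𝔸) →ₗ[ℂ] (SiteY i → 𝔸) := GpCubeY i c (parSymY i) V' with hBc
  set GK : (SiteY i → 𝔸) →ₗ[ℂ] (SiteY i → 𝔸) := Bc * (deltaPrimeACubeY i c (parSymY i) V' * cutMulY (𝔸 := 𝔸) (chiY i c) -
    cutMulY (𝔸 := 𝔸) (chiY i c) * deltaPrimeACubeY i c (parSymY i) V') with hGKdef
  set Y : (SiteY i → 𝔸) →ₗ[ℂ] (SiteY i → 𝔸) := cutMulY (𝔸 := 𝔸) (chiY i c) - GK with hY
  set Dr : Module.End ℝ (SiteY i × ι → ℝ) := conj b (diffLetter (shiftY i) (UboxY i (cfg U₁)) (((etaS i : ℝ) : ℂ))⁻¹ (Sum.inr ν)) with hDr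
  -- §1's identity, and the operator in p38's split shape
  have hid : Bc * cutMulY (𝔸 := 𝔸) χl = (Y ∘ₗ Ac) ∘ₗ cutMulY (𝔸 := 𝔸) χl := by
    rw [hBc, hY, hGKdef, hBc, hAc, hχl, hV', GpCubeY_mul_cutMulY_eq_at i c g (cfg U₁) η A hQ hgA hU hV]
    rfl
  have e1 : conj b (((((etaS i ^ 2 : ℝ) : ℂ)) • Bc).restrictScalars ℝ) * mulOp (fun p : SiteY i × ι => χl p.1) =
      conj b (((etaS i ^ 2) • ((Y ∘ₗ Ac) ∘ₗ cutMulY (𝔸 := 𝔸) χl)).restrictScalars ℝ) := by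
    rw [← conj_cutMulY b χl, ← B9Eq352DivFormLetters.conj_mul]
    refine congrArg (conj b) (LinearMap.ext fun Λ => ?_)
    have h1 : Bc (cutMulY (𝔸 := 𝔸) χl Λ) = Y (Ac (cutMulY (𝔸 := 𝔸) χl Λ)) := by
      have := congrArg (fun T : (SiteY i → 𝔸) →ₗ[ℂ] (SiteY i → 𝔸) => T Λ) hid
      simpa only [Module.End.mul_apply, LinearMap.coe_comp, Function.comp_apply] using this
    simp only [Module.End.mul_apply, LinearMap.restrictScalars_apply, LinearMap.smul_apply, LinearMap.coe_comp, Function.comp_apply, h1]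
    exact algebraMap_smul ℂ (etaS i ^ 2) (Y (Ac (cutMulY (𝔸 := 𝔸) χl Λ)))
  rw [e1, conj_cut_gradB_split i b (cfg U₁) (etaS i) ν χl Y Ac]
  -- the two column pieces from `hE`, indicators dropped, rates relaxed to `ρδ₀`
  have hρaG : ρ * δ₀ ≤ (aG - α) * δ₀ := mul_le_mul_of_nonneg_right hρG hδ₀
  have hρδG : ρ * δ₀ ≤ δG := by nlinarith [mul_nonneg hα hδ₀]
  have hP1 : HasMajorant (g := toB6 (geo9K i) Rr' Hp) blk
      (conj b (((etaS i ^ 2) • Ac).restrictScalars ℝ) * Dr * mulOp (fun p : SiteY i × ι => χl (shiftY i ν p.1)))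
      (fun (a b' : (geo9K i).Site) => (M₂ * (∑ j, ‖b j‖) * BG) * (geo9K i).len a * Real.exp (-(ρ * δ₀ * (geo9K i).dist a b'))) := by
    refine hasMajorant_mono (g := toB6 (geo9K i) Rr' Hp) _
      (hasMajorant_colL_G_gradB i c b cfg (fun W => GpY i (parSymY i) W) (parSymY i) (Rr := Rr') (Hp := Hp) hE hBG ιB hι hM₂ hrepr ν) fun a b' => ?_
    have hnn : 0 ≤ M₂ * (∑ j, ‖b j‖) * BG * (geo9K i).len a * Real.exp (-(δG * (geo9K i).dist a b')) := by
      have := hlen0 a; positivity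
    refine le_trans (mul_le_of_le_one_left hnn (by split_ifs <;> norm_num)) ?_
    exact mul_le_mul_of_nonneg_left (Real.exp_le_exp.2 (neg_le_neg (mul_le_mul_of_nonneg_right hρδG (hdnn a b')))) (by have := hlen0 a; positivity)
  have hP2 : HasMajorant (g := toB6 (geo9K i) Rr' Hp) blk
      (conj b (((etaS i ^ 2) • Ac).restrictScalars ℝ) * mulOp (fun p : SiteY i × ι => (etaS i)⁻¹ * (χl p.1 - χl (shiftY i ν p.1))))
      (fun (a b' : (geo9K i).Site) => (M₂ * (∑ j, ‖b j‖) * BG * Λ * (D1 thetaProf / 3)) * (geo9K i).len a * Real.exp (-(ρ * δ₀ * (geo9K i).dist a b'))) := by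
    refine hasMajorant_mono (g := toB6 (geo9K i) Rr' Hp) _
      (hasMajorant_colL_G_dchi i c b cfg (fun W => GpY i (parSymY i) W) (parSymY i) (Rr := Rr') (Hp := Hp) hE hBG ιB hι hM₂ hrepr hη ν haG hΛ hT1)
      fun a b' => ?_
    have hnn : 0 ≤ M₂ * (∑ j, ‖b j‖) * BG * Λ * (D1 thetaProf / 3) * (geo9K i).len a * Real.exp (-((aG - α) * δ₀ * (geo9K i).dist a b')) := by
      have := hlen0 a; positivity
    refine le_trans (mul_le_of_le_one_left hnn (by split_ifs <;> norm_num)) ?_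
    exact mul_le_mul_of_nonneg_left (Real.exp_le_exp.2 (neg_le_neg (mul_le_mul_of_nonneg_right hρaG (hdnn a b')))) (by have := hlen0 a; positivity)
  -- their sum `P`
  set P : Module.End ℝ (SiteY i × ι → ℝ) := conj b (((etaS i ^ 2) • Ac).restrictScalars ℝ) * Dr * mulOp (fun p : SiteY i × ι => χl (shiftY i ν p.1)) +
    conj b (((etaS i ^ 2) • Ac).restrictScalars ℝ) * mulOp (fun p : SiteY i × ι => (etaS i)⁻¹ * (χl p.1 - χl (shiftY i ν p.1))) with hPdef
  have hP : HasMajorant (g := toB6 (geo9K i) Rr' Hp) blk P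
      (fun (a b' : (geo9K i).Site) => (M₂ * (∑ j, ‖b j‖) * BG + M₂ * (∑ j, ‖b j‖) * BG * Λ * (D1 thetaProf / 3)) * (geo9K i).len a *
        Real.exp (-(ρ * δ₀ * (geo9K i).dist a b'))) :=
    hasMajorant_mono (g := toB6 (geo9K i) Rr' Hp) _ (hasMajorant_add (g := toB6 (geo9K i) Rr' Hp) blk hP1 hP2) fun a b' => le_of_eq (by ring)
  -- the prefactor `conj(Y^ℝ) = M_{χ_□}♯ − conj(GK^ℝ)`
  have eY : conj b (Y.restrictScalars ℝ) = mulOp (fun p : SiteY i × ι => chiY i c p.1) - conj b (GK.restrictScalars ℝ) := by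
    rw [hY, show ((cutMulY (𝔸 := 𝔸) (chiY i c) - GK).restrictScalars ℝ : Module.End ℝ (SiteY i → 𝔸)) =
      (cutMulY (𝔸 := 𝔸) (chiY i c)).restrictScalars ℝ - GK.restrictScalars ℝ from LinearMap.ext fun _ => rfl, B9Eq352DivFormLetters.conj_sub, conj_cutMulY]
  have eop : T * (conj b (Y.restrictScalars ℝ) * (conj b (((etaS i ^ 2) • Ac).restrictScalars ℝ) * Dr) * mulOp (fun p : SiteY i × ι => χl (shiftY i ν p.1)) +
        conj b (Y.restrictScalars ℝ) * conj b (((etaS i ^ 2) • Ac).restrictScalars ℝ) *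
          mulOp (fun p : SiteY i × ι => (etaS i)⁻¹ * (χl p.1 - χl (shiftY i ν p.1)))) =
      T * mulOp (fun p : SiteY i × ι => chiY i c p.1) * P - T * conj b (GK.restrictScalars ℝ) * P := by
    rw [eY, hPdef]
    simp only [sub_mul, mul_sub, mul_add, mul_assoc]
    abel
  rw [hDr] at eop
  rw [eop]
  have hK0 : 0 ≤ M₂ * (∑ j, ‖b j‖) * BG + M₂ * (∑ j, ‖b j‖) * BG * Λ * (D1 thetaProf / 3) := by positivity
  have hρδ : 0 ≤ ρ * δ₀ := mul_nonneg hρ hδ₀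
  have h1 := mul_decay_majorant_blk (Rg := Rr') (Hg := Hp) blk dB w₁ (fun a => (geo9K i).len a) hκ₁ hK0 hΛ hw₁ hlen0 hρδ hr₁ hdnn htri hT1 h261 hTM hP
  have h2 := mul_decay_majorant_blk (Rg := Rr') (Hg := Hp) blk dB w₁ (fun a => (geo9K i).len a) hκ₂ hK0 hΛ hw₁ hlen0 hρδ hr₁ hdnn htri hT1 h261 hTK hP
  refine hasMajorant_mono (g := toB6 (geo9K i) Rr' Hp) _ (hasMajorant_sub (g := toB6 (geo9K i) Rr' Hp) blk h1 h2) fun a b' => le_of_eq ?_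
  ring

end Right

/-! ## §3  The left entry `conj(η⁻¹∇_μ)·M_{χl}·conj(η²G′_□(V′))` (FILE 7's `hLw □ μ`), rows located -/

section Left

variable [Fintype (geo9K i).Site] [DecidableEq (geo9K i).Site] {Rr : ℝ} {H : Prop} {Rr' : ℝ} {Hp : Prop}
variable {B : B9.Backgrounds} (cfg : B.Cfg → CfgY 𝔸 i) {U₁ : B.Cfg}

open Classical in
set_option maxHeartbeats 3200000 in
/-- ★★★ **FILE 7's `hLw □ μ` FROM `hE` AND p21 D3's `hR`**: `conj(η⁻¹∇_μ(U₁))·M_{χl}♯·conj((η²G′_□(V′))^ℝ) ≺ 𝟙[a ∈ S_L]·κ_L·ℓ(a)·e^{−ρδ₀d}`,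
`S_L = {blocks meeting NearC(21S_j∕8 + 1)}`, `κ_L = (K₁ + |η⁻¹|(D₁θ∕(3S_j))(S_jη_k)K₁)(1 + (M₂Σ‖b_j‖)²θc₁(dB_c, δ_c, α_c)·c₁(dB, δ₀, β))`, `K₁ = M₂Σ‖b_j‖B_G` —
§1's left identity, p33's (3.100) engine `hasMajorant_leftFactor`, F3-E2d's member transfer of `hR`, FILE 4's located chain.
[cite: Balaban1985BackgroundPropagators, p.415 l.29–31, p.412 l.22–36, (3.97) p.412, (3.100) p.413, Thm 3.1 (3.42) p.397, (3.49) p.399, (3.88)–(3.89) p.409, Cor. 3.6 p.408; Balaban1983RegularityDecay, (1.11)–(1.12) (statement type); Balaban1984PropagatorsII, (2.1) p.224, (2.51)–(2.52) p.232, (2.46) p.231, Lemma 2.1 (2.60)–(2.61) p.234] -/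
theorem hasMajorant_leftEntry_at {BG δG : ℝ} (hE : EBlock (kernelFamilySInv i B cfg (fun W => GpY i (parSymY i) W) (parSymY i)) BG δG U₁) (hBG : 0 ≤ BG)
    (ιB : BlkY i → IBondY i) (hι : ∀ s, β i.hN i.D i.hk (ιB s) = s)
    {M₂ : ℝ} (hM₂ : 0 ≤ M₂) (hrepr : ∀ (v : 𝔸) (j : ι), |b.repr v j| ≤ M₂ * ‖v‖) (μ : Fin (d + 1))
    (g : GaugeY 𝔸 i) (hg : ∀ x, ‖((g x : 𝔸ˣ) : 𝔸)‖ ≤ 1 ∧ ‖(((g x)⁻¹ : 𝔸ˣ) : 𝔸)‖ ≤ 1) (η : ℝ) (A : AfldY 𝔸 i) {Q : Set (Site (PV d ℓ i.m i.K hd hL) 0)}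
    (hQ : ∀ x : Site (PV d ℓ i.m i.K hd hL) 0, NearC i c (35 * SC i c / 8 + 1) (boxEquiv i.hN x).1 → x ∈ Q)
    (hgA : ∀ (κ : Fin (d + 1)) (x : Site (PV d ℓ i.m i.K hd hL) 0), x ∈ Q → x.shift κ ∈ Q → gaugeY i g (cfg U₁) κ x = fluct η A κ x)
    (hU : IsUnit (deltaPrimeAY i (parSymY i) (cfg U₁))) (hV : IsUnit (deltaPrimeACubeY i c (parSymY i) (gaugeY i g⁻¹ (locCfgY i c η A))))
    (dBc : ℕ) {θ δc αc : ℝ} (hθ : 0 ≤ θ) (hδc : 0 ≤ δc) (hαc1 : αc ≤ 1) (h261c : Ineq261 dBc (toB6 (geoCK i c) Rr H) δc αc)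
    (hR : HasMajorant (g := toB6 (geoCK i c) Rr H) (fun p : SiteY i × ι => blkCubeY i c p.1)
      (conj b (((cutMulY (𝔸 := 𝔸) (chiY i c) * deltaPrimeACubeY i c (parSymY i) (locCfgY i c η A) -
          deltaPrimeACubeY i c (parSymY i) (locCfgY i c η A) * cutMulY (𝔸 := 𝔸) (chiY i c)) * GpCubeY i c (parSymY i) (locCfgY i c η A)).restrictScalars ℝ))
      (fun a s' => θ * Real.exp (-(δc * (geoCK i c).dist a s'))))
    (dB : ℕ) {δ₀ ρ α β' : ℝ} (hδ₀ : 0 ≤ δ₀) (hρ : 0 ≤ ρ) (hαδ : 0 ≤ α * δ₀) (hβδ : 0 ≤ β' * δ₀) (hρG : ρ * δ₀ + (α + β') * δ₀ ≤ δG)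
    (hrate : ρ * δ₀ ≤ (1 - αc) * δc) (h261 : Ineq261 dB (toB6 (geo9K i) Rr' Hp) δ₀ β') :
    HasMajorant (g := toB6 (geo9K i) Rr' Hp) (fun p : SiteY i × ι => ιB (blkOf i.D.toDomains p.1))
      (conj b (diffLetter (shiftY i) (UboxY i (cfg U₁)) (((etaS i : ℝ) : ℂ))⁻¹ (Sum.inl μ)) * mulOp (fun p : SiteY i × ι => bumpY i (ctrR i c) (3 * (SC i c : ℝ)) p.1) *
        conj b (((((etaS i ^ 2 : ℝ) : ℂ)) • GpCubeY i c (parSymY i) (gaugeY i g⁻¹ (locCfgY i c η A))).restrictScalars ℝ))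
      (fun a a' : (geo9K i).Site => (if a ∈ (Finset.univ.filter fun a : (geo9K i).Site => ∃ z : SiteY i, ιB (blkOf i.D.toDomains z) = a ∧ NearC i c (21 * SC i c / 8 + 1) z.1)
        then (1 : ℝ) else 0) *
        (((M₂ * (∑ j, ‖b j‖) * BG + (|(etaS i)⁻¹| * (D1 thetaProf / (3 * (SC i c : ℝ)))) * ((SC i c : ℝ) * (kGeo i).eta) * (M₂ * (∑ j, ‖b j‖) * BG)) *
            (1 + ((M₂ * ∑ j, ‖b j‖) ^ 2 * (θ * B6.c1 dBc δc αc)) * B6.c1 dB δ₀ β')) *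
          (geo9K i).len a * Real.exp (-(ρ * δ₀ * (geo9K i).dist a a')))) := by
  obtain ⟨htri, hsymm, hdnn⟩ := geo9K_axioms i Rr' Hp
  have hS1 := one_le_SC i c
  have hSb : 0 ≤ ∑ j, ‖b j‖ := Finset.sum_nonneg fun _ _ => norm_nonneg _
  have hD1 : 0 ≤ D1 thetaProf := D1_nonneg contDiff_thetaProf hasCompactSupport_thetaProf
  have hlen0 : ∀ y : (geo9K i).Site, 0 ≤ (geo9K i).len y := fun y => (geo9K_len_pos i y).le
  have hc1 : 0 ≤ B6.c1 dB δ₀ β' := c1_nonneg _ _ _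
  have hc1c : 0 ≤ B6.c1 dBc δc αc := c1_nonneg _ _ _
  set V' : CfgY 𝔸 i := gaugeY i g⁻¹ (locCfgY i c η A) with hV'
  set χl : SiteY i → ℝ := bumpY i (ctrR i c) (3 * (SC i c : ℝ)) with hχl
  set blk : SiteY i × ι → (geo9K i).Site := fun p => ιB (blkOf i.D.toDomains p.1) with hblk
  set SL : Finset (geo9K i).Site :=
    Finset.univ.filter (fun a : (geo9K i).Site => ∃ z : SiteY i, ιB (blkOf i.D.toDomains z) = a ∧ NearC i c (21 * SC i c / 8 + 1) z.1) with hSL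
  set Ac : (SiteY i → 𝔸) →ₗ[ℂ] (SiteY i → 𝔸) := GpY i (parSymY i) (cfg U₁) with hAc
  set Bc : (SiteY i → 𝔸) →ₗ[ℂ] (SiteY i → 𝔸) := GpCubeY i c (parSymY i) V' with hBc
  set Rc : (SiteY i → 𝔸) →ₗ[ℂ] (SiteY i → 𝔸) := (cutMulY (𝔸 := 𝔸) (chiY i c) * deltaPrimeACubeY i c (parSymY i) V' -
    deltaPrimeACubeY i c (parSymY i) V' * cutMulY (𝔸 := 𝔸) (chiY i c)) * Bc with hRcdef
  set Y : (SiteY i → 𝔸) →ₗ[ℂ] (SiteY i → 𝔸) := cutMulY (𝔸 := 𝔸) (chiY i c) - Rc with hY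
  set Dl : Module.End ℝ (SiteY i × ι → ℝ) := conj b (diffLetter (shiftY i) (UboxY i (cfg U₁)) (((etaS i : ℝ) : ℂ))⁻¹ (Sum.inl μ)) with hDl
  set G₀ : Module.End ℝ (SiteY i → 𝔸) := ((((etaS i ^ 2 : ℝ) : ℂ)) • Ac).restrictScalars ℝ with hG₀
  set G : Module.End ℝ (SiteY i × ι → ℝ) := conj b G₀ with hGdef
  -- §1's identity: `M_{χl}♯·conj(η²Bc) = M_{χl}♯·conj(η²Ac)·conj(Y)`
  have hid : cutMulY (𝔸 := 𝔸) χl * Bc = cutMulY (𝔸 := 𝔸) χl * Ac * Y := by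
    rw [hBc, hY, hRcdef, hBc, hAc, hχl, hV', cutMulY_mul_GpCubeY_eq_at i c g (cfg U₁) η A hQ hgA hU hV]
  have e1 : mulOp (fun p : SiteY i × ι => χl p.1) * conj b (((((etaS i ^ 2 : ℝ) : ℂ)) • Bc).restrictScalars ℝ) =
      mulOp (fun p : SiteY i × ι => χl p.1) * G * conj b (Y.restrictScalars ℝ) := by
    rw [hGdef, hG₀, ← conj_cutMulY b χl, ← B9Eq352DivFormLetters.conj_mul, ← B9Eq352DivFormLetters.conj_mul, ← B9Eq352DivFormLetters.conj_mul]
    refine congrArg (conj b) (LinearMap.ext fun Λ => ?_)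
    have h1 : ∀ Λ' : SiteY i → 𝔸, cutMulY (𝔸 := 𝔸) χl (Bc Λ') = cutMulY (𝔸 := 𝔸) χl (Ac (Y Λ')) := fun Λ' => by
      have := congrArg (fun T : (SiteY i → 𝔸) →ₗ[ℂ] (SiteY i → 𝔸) => T Λ') hid
      simpa only [Module.End.mul_apply] using this
    simp only [Module.End.mul_apply, LinearMap.restrictScalars_apply, LinearMap.smul_apply, map_smul, h1]
  rw [mul_assoc, e1, ← mul_assoc, ← mul_assoc]
  -- the left factor `Dl·M_{χl}♯·G` (rows located), from `hE`'s entries through the cut-off ((3.100))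
  have hη0 : 0 ≤ (kGeo i).eta := by
    show (0 : ℝ) ≤ |i.cf|⁻¹
    positivity
  have hℓS : ∀ a ∈ SL, (geo9K i).len a ^ 2 ≤ ((SC i c : ℝ) * (kGeo i).eta) * (geo9K i).len a := fun a ha => by
    obtain ⟨z, rfl, hz⟩ := (Finset.mem_filter.1 ha).2
    have hle : (geo9K i).len (ιB (blkOf i.D.toDomains z)) ≤ (SC i c : ℝ) * (kGeo i).eta := by
      rw [geo9K_len_site i ιB hι z]
      refine mul_le_mul_of_nonneg_right ?_ hη0
      have h1 := pow_levY_le_SC i c (r := 21 * SC i c / 8 + 1) (by omega) hz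
      have h2 : (((ℓ + 1) ^ Node00.levY i z : ℕ) : ℝ) ≤ ((SC i c : ℤ) : ℝ) := by exact_mod_cast h1
      push_cast at h2
      exact h2
    rw [sq]
    exact mul_le_mul_of_nonneg_right hle (geo9K_len_pos i _).le
  have hDG := hasMajorant_gradF_mul_G_of_eBlockInv i b cfg (fun W => GpY i (parSymY i) W) (parSymY i) (Rr := Rr') (Hp := Hp) hE hBG ιB hι hM₂ hrepr
    (η := etaS i) rfl (Uc := UboxY i (cfg U₁)) rfl G₀ (fun Λ => restrict_smul_apply i (etaS i) Ac Λ) μ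
  have hG := hasMajorant_conj_G_of_eBlockInv i b cfg (fun W => GpY i (parSymY i) W) (parSymY i) (Rr := Rr') (Hp := Hp) hE hBG ιB hι hM₂ hrepr
    (η := etaS i) rfl G₀ (fun Λ => restrict_smul_apply i (etaS i) Ac Λ)
  have hLF := hasMajorant_leftFactor (Rg := Rr') (Hg := Hp) blk (fun p : SiteY i × ι => χl p.1) (fun p : SiteY i × ι => χl (shiftY i μ p.1))
    (fun p : SiteY i × ι => (etaS i)⁻¹ * (χl (shiftY i μ p.1) - χl p.1)) (fun a => (geo9K i).len a) (fun a => (geo9K i).len a ^ 2) SL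
    (by positivity : 0 ≤ M₂ * (∑ j, ‖b j‖) * BG)
    (mul_nonneg (abs_nonneg ((etaS i)⁻¹)) (div_nonneg hD1 (three_SC_pos i c).le) : 0 ≤ |(etaS i)⁻¹| * (D1 thetaProf / (3 * (SC i c : ℝ))))
    (conj_diffLetter_mul_cutMulY i b (cfg U₁) (etaS i) μ χl)
    (fun p => abs_chiL_le_one i c _) (fun p hp => ?_) (fun p => ?_) (fun p hp => ?_) hℓS hDG hG
  rotate_left
  · by_contra h
    exact hp (Finset.mem_filter.2 ⟨Finset.mem_univ _, p.1, rfl, nearC_of_chiL_shiftY_ne_zero i c μ h⟩)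
  · rw [abs_mul]
    exact mul_le_mul_of_nonneg_left (abs_chiL_shiftY_sub_le i c μ p.1) (abs_nonneg _)
  · by_contra h
    have h' : χl (shiftY i μ p.1) - χl p.1 ≠ 0 := fun h0 => h (by rw [h0, mul_zero])
    by_cases h1 : χl (shiftY i μ p.1) = 0
    · have h2 : χl p.1 ≠ 0 := fun h2 => h' (by rw [h1, h2, sub_zero])
      exact hp (Finset.mem_filter.2 ⟨Finset.mem_univ _, p.1, rfl, (nearC_of_chiL_ne_zero i c h2).mono i c (by omega)⟩)
    · exact hp (Finset.mem_filter.2 ⟨Finset.mem_univ _, p.1, rfl, nearC_of_chiL_shiftY_ne_zero i c μ h1⟩)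
  -- the right factor `conj(Y^ℝ) = M_{χ_□}♯ − conj(R_χ(V′)^ℝ)`; `R_χ` on the member carrier from `hR` (F3-E2d)
  have eY : conj b (Y.restrictScalars ℝ) = mulOp (fun p : SiteY i × ι => chiY i c p.1) - conj b (Rc.restrictScalars ℝ) := by
    rw [hY, show ((cutMulY (𝔸 := 𝔸) (chiY i c) - Rc).restrictScalars ℝ : Module.End ℝ (SiteY i → 𝔸)) =
      (cutMulY (𝔸 := 𝔸) (chiY i c)).restrictScalars ℝ - Rc.restrictScalars ℝ from LinearMap.ext fun _ => rfl, B9Eq352DivFormLetters.conj_sub, conj_cutMulY]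
  have hRcm := hasMajorant_conj_commStep_member i c b (Rr := Rr) (H := H) (Rr' := Rr') (Hp := Hp) hM₂ hrepr (Node00.parSymY_isGaugeLawS i) g hg
    (locCfgY i c η A) ιB hι dBc hθ hδc hαc1 h261c hR
  rw [eY, mul_sub]
  set K₁ : ℝ := M₂ * (∑ j, ‖b j‖) * BG + (|(etaS i)⁻¹| * (D1 thetaProf / (3 * (SC i c : ℝ)))) * ((SC i c : ℝ) * (kGeo i).eta) * (M₂ * (∑ j, ‖b j‖) * BG)
    with hK₁
  have hK₁0 : 0 ≤ K₁ := by positivity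
  set κRc : ℝ := (M₂ * ∑ j, ‖b j‖) ^ 2 * (θ * B6.c1 dBc δc αc) with hκRc
  have hκRc0 : 0 ≤ κRc := by positivity
  have hρδ : 0 ≤ ρ * δ₀ := mul_nonneg hρ hδ₀
  have hρδG : ρ * δ₀ ≤ δG := by linarith
  -- `(left factor)·M_{χ_□}♯` and `(left factor)·conj(R_χ)` (FILE 4's located chain, constant weight on `R_χ`)
  have h1 := hasMajorant_mul_mulOp_right (R := Rr') (H := Hp) blk hLF (fun p : SiteY i × ι => chiY i c p.1) (fun p => (abs_chiY_le_one i c p.1).1)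
    Finset.univ (fun p _ => Finset.mem_univ _)
  have hRc' : HasMajorant (g := toB6 (geo9K i) Rr' Hp) blk (conj b (Rc.restrictScalars ℝ))
      (fun (a b' : (geo9K i).Site) => κRc * (fun _ : (geo9K i).Site => (1 : ℝ)) a * Real.exp (-(ρ * δ₀ * (geo9K i).dist a b'))) := by
    refine hasMajorant_mono (g := toB6 (geo9K i) Rr' Hp) _ hRcm fun a b' => ?_
    rw [mul_one, ← mul_assoc]
    exact mul_le_mul_of_nonneg_left (Real.exp_le_exp.2 (neg_le_neg (mul_le_mul_of_nonneg_right hrate (hdnn a b')))) hκRc0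
  have h2 := chain_majorant_blk (Rg := Rr') (Hg := Hp) blk dB SL (fun a => (geo9K i).len a) (fun _ : (geo9K i).Site => (1 : ℝ)) hK₁0 hκRc0 zero_le_one hlen0
    (fun _ => zero_le_one) hρδ hρG hdnn htri (scaleTransfer_one hαδ hdnn) h261 hLF hRc'
  refine hasMajorant_mono (g := toB6 (geo9K i) Rr' Hp) _ (hasMajorant_sub (g := toB6 (geo9K i) Rr' Hp) blk h1 h2) fun (a b' : (geo9K i).Site) => ?_
  show (if b' ∈ (Finset.univ : Finset (geo9K i).Site) then (1 : ℝ) else 0) * ((if a ∈ SL then (1 : ℝ) else 0) * _) + (if a ∈ SL then (1 : ℝ) else 0) * _ ≤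
    (if a ∈ SL then (1 : ℝ) else 0) * _
  rw [if_pos (Finset.mem_univ _), one_mul]
  by_cases ha : a ∈ SL
  · rw [if_pos ha, one_mul, one_mul, one_mul]
    have hl := hlen0 a
    have hexp : Real.exp (-(δG * (geo9K i).dist a b')) ≤ Real.exp (-(ρ * δ₀ * (geo9K i).dist a b')) :=
      Real.exp_le_exp.2 (neg_le_neg (mul_le_mul_of_nonneg_right hρδG (hdnn a b')))
    have hA : K₁ * (geo9K i).len a * Real.exp (-(δG * (geo9K i).dist a b')) ≤ K₁ * (geo9K i).len a * Real.exp (-(ρ * δ₀ * (geo9K i).dist a b')) :=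
      mul_le_mul_of_nonneg_left hexp (mul_nonneg hK₁0 hl)
    calc K₁ * (geo9K i).len a * Real.exp (-(δG * (geo9K i).dist a b')) +
          K₁ * κRc * 1 * B6.c1 dB δ₀ β' * ((geo9K i).len a * 1) * Real.exp (-(ρ * δ₀ * (geo9K i).dist a b'))
        ≤ K₁ * (geo9K i).len a * Real.exp (-(ρ * δ₀ * (geo9K i).dist a b')) +
          K₁ * κRc * 1 * B6.c1 dB δ₀ β' * ((geo9K i).len a * 1) * Real.exp (-(ρ * δ₀ * (geo9K i).dist a b')) := by linarith
      _ = _ := by ring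
  · rw [if_neg ha, zero_mul, zero_mul, zero_mul, add_zero]

end Left

end Literature.MathematicalPhysics.QuantumFieldTheory.Balaban1983to89.B9Eq3105FamThreeLocCDiffOuterEntries
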